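import Summits.ValiantsHypothesis.ValiantsHypothesis.Theorems.MatrixDescartes.Negative.HexadecadeWTowerItinerary

/-!
PLACEMENT NOTE. NEGATIVE knowledge in the Literature (τ) currency, homed under `Theorems/MatrixDescartes/Negative/`
(files 3–4, appended to the two-file cut `HexadecadeSector` / `HexadecadeWTower`): the all-level grid-sign theorem of the
W-tower, text VERBATIM from the planner seat val-idea-13 g1's kernel workfile `Cruxes/MatrixDescartes/Lines/hexadecade.lean`
v10 (§ «The Joukowski itinerary», accepted by critic val-idea-crit-4 as the PB3 appendix, NOTE #7a / ruling g12-R161 (c)),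
split at the seam «the error sum is small» for the 400-line rule, with exactly five lint edits (four unused hypothesis binders
`_`-prefixed — arity and order unchanged —, one unused `simp` argument dropped), theorem docstrings added, and this header;
filed by val-idea-crit-4 g1 (filing hand of record for this lineage, g12-R163 (b)).  The crux `MatrixDescartes`
(`stmt-ValiantsHypothesis-18050`) is NOT touched; 0 provers; VP ≠ VNP is not moved; no summit statement is proved here.

# The hexadecadal sector lies INSIDE the `TauRealZeros` barrier (file 4): grid signs at every level, hence
# `¬ HexRealZeroTauBound c` for EVERY `c`

`namespace WTower` (continued from `HexadecadeWTowerItinerary`): the phase-A error sum is `≤ 1/50` (`SA_le`, via the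
injectivity of the itinerary on small values, `geomInj_le`), so `F_t ≤ 11/10` (`FA_le_const`); when the itinerary hits
`m_t = n_t` one Joukowski step lands in `[2, 2.2]` (`stepB`) and the remaining squaring-type steps keep the rescaled value
`≥ L/2.2 ≥ 64/2.2 > 4` (`stepCstart`, `stepC`); otherwise phase A persists to the end (`phaseA_of_noB`).  Hence
`vIt_final : v_k < 4 ⟺ i odd`, and:
* `wTowerSigns_all : ∀ k ≥ 1, WTowerSigns k`;
* **`not_hexRealZeroTauBound : ∀ c, ¬ HexRealZeroTauBound c`** — the hexadecadal (ratio-16 GP-separated, real-rooted)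
  sector does not escape the Chebyshev-type τ obstruction (`W_k`: `τ ≤ k² + 12k + 5`, `2^k` hexadecadal real roots).
  This un-conditions `not_hexRealZeroTauBound_of_wTowerSigns` (file 2) and extends the tree barrier
  `Literature.…TauRealZeros` / `not_separatedRealZeroTauBound` from metric to geometric separation.

[folklore] as in file 3.
-/

set_option linter.dupNamespace false

noncomputable section

namespace Summit.ValiantsHypothesis.ValiantsHypothesis.Theorems.LacunarySymmetroidMatrixDescartes.Hexadecade

open scoped BigOperators

namespace WTower

variable {k i : ℕ}

/-! #### the error sum is small: `S_t ≤ 1/50` -/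

/-- A sum of `(1/256)^(a s)` over an index set on which `a` is injective with values `≥ 1` is at most `1/255`. -/
theorem geomInj_le (T : Finset ℕ) (a : ℕ → ℕ) (hinj : ∀ x ∈ T, ∀ y ∈ T, a x = a y → x = y)
    (h1 : ∀ s ∈ T, 1 ≤ a s) : ∑ s ∈ T, (1 / 256 : ℝ) ^ a s ≤ 1 / 255 := by
  rw [← Finset.sum_image (f := fun μ => (1 / 256 : ℝ) ^ μ) hinj]
  have hsub : T.image a ⊆ Finset.Ico 1 (T.sup a + 1) := by
    intro μ hμ
    rw [Finset.mem_image] at hμ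
    obtain ⟨s, hs, rfl⟩ := hμ
    rw [Finset.mem_Ico]
    exact ⟨h1 s hs, Nat.lt_succ_of_le (Finset.le_sup (f := a) hs)⟩
  calc ∑ μ ∈ T.image a, (1 / 256 : ℝ) ^ μ
      ≤ ∑ μ ∈ Finset.Ico 1 (T.sup a + 1), (1 / 256 : ℝ) ^ μ :=
        Finset.sum_le_sum_of_subset_of_nonneg hsub (fun _ _ _ => by positivity)
    _ ≤ (1 / 256 : ℝ) ^ 1 / (1 - 1 / 256) := geom_sum_Ico_le_of_lt_one (by norm_num) (by norm_num)
    _ = 1 / 255 := by norm_num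

/-- `Small` is decidable (it is a numeric inequality). -/
instance (k i s : ℕ) : Decidable (Small k i s) := by unfold Small; infer_instance

/-- Phase A: the error sum is at most `1/50`. -/
theorem SA_le (_hk : 1 ≤ k) (_hi : i ≤ 2 ^ k) (t : ℕ) (ht : t ≤ k)
    (h : ∀ s, 1 ≤ s → s ≤ t → 1 ≤ mIt k i s) : SA k i t ≤ 1 / 50 := by
  have hx : ∀ s, xA k i s = (1 / 256 : ℝ) ^ mIt k i s := xA_eq
  unfold SA
  simp_rw [hx]
  set T := Finset.Icc 1 t with hT
  have hmem : ∀ s ∈ T, 1 ≤ s ∧ s ≤ t := fun s hs => by simpa [hT] using hs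
  rw [← Finset.sum_filter_add_sum_filter_not T (fun s => Small k i s)]
  -- small part
  have hsmall : ∑ s ∈ T.filter (fun s => Small k i s), (1 / 256 : ℝ) ^ mIt k i s ≤ 1 / 255 := by
    apply geomInj_le
    · intro x hx y hy hxy
      rw [Finset.mem_filter] at hx hy
      rcases lt_trichotomy x y with hlt | heq | hgt
      · exact absurd hxy (mIt_ne_of_small hlt (by linarith [(hmem y hy.1).2]) hy.2)
      · exact heq
      · exact absurd hxy.symm (mIt_ne_of_small hgt (by linarith [(hmem x hx.1).2]) hx.2)
    · intro s hs
      rw [Finset.mem_filter] at hs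
      exact h s (hmem s hs.1).1 (hmem s hs.1).2
  -- big part, early times `s ≤ k - 2`
  set B := T.filter (fun s => ¬ Small k i s) with hB
  rw [← Finset.sum_filter_add_sum_filter_not B (fun s => s + 2 ≤ k)]
  have hbig1 : ∑ s ∈ B.filter (fun s => s + 2 ≤ k), (1 / 256 : ℝ) ^ mIt k i s ≤ 1 / 255 := by
    calc ∑ s ∈ B.filter (fun s => s + 2 ≤ k), (1 / 256 : ℝ) ^ mIt k i s
        ≤ ∑ s ∈ B.filter (fun s => s + 2 ≤ k), (1 / 256 : ℝ) ^ (k - 1 - s) := by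
          apply Finset.sum_le_sum
          intro s hs
          rw [Finset.mem_filter, hB, Finset.mem_filter] at hs
          obtain ⟨⟨hsT, hns⟩, hs2⟩ := hs
          have hs1 := (hmem s hsT).1
          unfold Small at hns
          push Not at hns
          have hn : nS k (s - 1) = 4 * 2 ^ (k - 2 - s) := by
            simp only [nS]; rw [show k - 1 - (s - 1) = (k - 2 - s) + 2 by omega, pow_add]; norm_num; ring
          have hlt := Nat.lt_two_pow_self (n := k - 2 - s)
          apply pow_le_pow_of_le_one (by norm_num) (by norm_num)
          omega
      _ ≤ 1 / 255 := by
          apply geomInj_le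
          · intro x hx y hy hxy
            simp only [Finset.mem_filter] at hx hy
            omega
          · intro s hs
            simp only [Finset.mem_filter] at hs
            omega
  -- big part, the last two times `s ∈ {k-1, k}`
  have hbig2 : ∑ s ∈ B.filter (fun s => ¬ (s + 2 ≤ k)), (1 / 256 : ℝ) ^ mIt k i s ≤ 2 * (1 / 256) := by
    have hcard : (B.filter (fun s => ¬ (s + 2 ≤ k))).card ≤ 2 := by
      calc (B.filter (fun s => ¬ (s + 2 ≤ k))).card ≤ ({k - 1, k} : Finset ℕ).card := by
            apply Finset.card_le_card
            intro s hs
            simp only [Finset.mem_filter, hB] at hs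
            have := (hmem s hs.1.1).2
            simp only [Finset.mem_insert, Finset.mem_singleton]
            omega
        _ ≤ 2 := Finset.card_le_two
    calc ∑ s ∈ B.filter (fun s => ¬ (s + 2 ≤ k)), (1 / 256 : ℝ) ^ mIt k i s
        ≤ ∑ s ∈ B.filter (fun s => ¬ (s + 2 ≤ k)), (1 / 256 : ℝ) := by
          apply Finset.sum_le_sum
          intro s hs
          simp only [Finset.mem_filter, hB] at hs
          have h1s := h s (hmem s hs.1.1).1 (hmem s hs.1.1).2
          calc (1 / 256 : ℝ) ^ mIt k i s ≤ (1 / 256 : ℝ) ^ 1 :=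
                pow_le_pow_of_le_one (by norm_num) (by norm_num) h1s
            _ = 1 / 256 := by norm_num
      _ = (B.filter (fun s => ¬ (s + 2 ≤ k))).card * (1 / 256) := by
          rw [Finset.sum_const, nsmul_eq_mul]
      _ ≤ 2 * (1 / 256) := by
          have : ((B.filter (fun s => ¬ (s + 2 ≤ k))).card : ℝ) ≤ 2 := by exact_mod_cast hcard
          nlinarith
  linarith

/-- Phase A: the error product is at most `11/10`. -/
theorem FA_le_const (hk : 1 ≤ k) (hi : i ≤ 2 ^ k) (t : ℕ) (ht : t ≤ k)
    (h : ∀ s, 1 ≤ s → s ≤ t → 1 ≤ mIt k i s) : FA k i t ≤ 11 / 10 := by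
  have hS := SA_le hk hi t ht h
  have := FA_le (k := k) (i := i) t (by linarith)
  calc FA k i t ≤ 1 / (1 - SA k i t) := this
    _ ≤ 1 / (1 - 1 / 50) := by
        apply div_le_div_of_nonneg_left (by norm_num) (by norm_num) (by linarith)
    _ ≤ 11 / 10 := by norm_num

/-! #### phases B and C -/

/-- Phase B: one Joukowski step from `[L/F, L·F]` with `F ≤ 11/10` lands in `[2, 2.2]` (after rescaling by `L`). -/
theorem stepB (L F v : ℝ) (hL : 0 < L) (hF : F ≤ 11 / 10) (hlo : L / F ≤ v)
    (hhi : v ≤ L * F) (hv : 0 < v) :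
    2 ≤ v / L + L / v ∧ v / L + L / v ≤ 22 / 10 := by
  have hF0 : 0 < F := by
    by_contra h0; push Not at h0
    have : L * F ≤ 0 := by nlinarith
    linarith
  rw [div_le_iff₀ hF0] at hlo
  rw [div_add_div _ _ hL.ne' hv.ne', le_div_iff₀ (by positivity), div_le_iff₀ (by positivity)]
  have hvL : v ≤ 11 / 10 * L := by nlinarith [mul_le_mul_of_nonneg_left hF hL.le]
  have hLv : L ≤ 11 / 10 * v := by nlinarith [mul_le_mul_of_nonneg_left hF hv.le]
  constructor
  · nlinarith [sq_nonneg (v - L)]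
  · have h1 : v * v ≤ (11 / 10 * L) * v := mul_le_mul_of_nonneg_right hvL hv.le
    have h2 : L * L ≤ (11 / 10 * v) * L := mul_le_mul_of_nonneg_right hLv hL.le
    nlinarith

/-- Phase C, first step: from `[2, 2.2]` the next rescaled Joukowski value lies in `[L/2.2, L/2 + 2.3/L]` (`L ≥ 16`). -/
theorem stepCstart (L v : ℝ) (hL : 16 ≤ L) (h2 : 2 ≤ v) (h22 : v ≤ 22 / 10) :
    L / (22 / 10) ≤ v / L + L / v ∧ v / L + L / v ≤ L / 2 + (23 / 10) / L := by
  have hL0 : 0 < L := by linarith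
  have hv : 0 < v := by linarith
  constructor
  · have h1 : L / (22 / 10) ≤ L / v := div_le_div_of_nonneg_left hL0.le hv h22
    have h2 : 0 ≤ v / L := by positivity
    linarith
  · have h1 : L / v ≤ L / 2 := div_le_div_of_nonneg_left hL0.le (by norm_num) h2
    have h3 : v / L ≤ (23 / 10) / L := div_le_div_of_nonneg_right (by linarith) hL0.le
    linarith

/-- Phase C, generic step: the window `[L²/2.2, L²/2 + 2.3/L²]` is mapped into `[L/2.2, L/2 + 2.3/L]` (`L ≥ 16`). -/
theorem stepC (L v : ℝ) (hL : 16 ≤ L) (hlo : L ^ 2 / (22 / 10) ≤ v)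
    (hhi : v ≤ L ^ 2 / 2 + (23 / 10) / L ^ 2) :
    L / (22 / 10) ≤ v / L + L / v ∧ v / L + L / v ≤ L / 2 + (23 / 10) / L := by
  have hL0 : 0 < L := by linarith
  have hv : 0 < v := lt_of_lt_of_le (by positivity) hlo
  constructor
  · have h1 : L / (22 / 10) ≤ v / L := by
      rw [le_div_iff₀ hL0]
      have : L ^ 2 / (22 / 10) = L / (22 / 10) * L := by ring
      linarith
    have h2 : 0 ≤ L / v := by positivity
    linarith
  · have h1 : v / L ≤ L / 2 + (23 / 10) / L ^ 3 := by
      have := div_le_div_of_nonneg_right hhi hL0.le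
      have e : (L ^ 2 / 2 + (23 / 10) / L ^ 2) / L = L / 2 + (23 / 10) / L ^ 3 := by
        field_simp
      linarith
    have h2 : L / v ≤ (22 / 10) / L := by
      have := div_le_div_of_nonneg_left hL0.le (by positivity : (0:ℝ) < L ^ 2 / (22 / 10)) hlo
      have e : L / (L ^ 2 / (22 / 10)) = (22 / 10) / L := by field_simp
      linarith
    have hL2 : (256:ℝ) ≤ L ^ 2 := by nlinarith
    have h3 : (23 / 10) / L ^ 3 ≤ (1 / 10) / L := by
      rw [div_le_div_iff₀ (by positivity) hL0]
      have : L ^ 3 = L * L ^ 2 := by ring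
      nlinarith [mul_le_mul_of_nonneg_left hL2 hL0.le]
    have h4 : (1 / 10) / L + (22 / 10) / L = (23 / 10) / L := by ring
    linarith

/-! #### the final sign theorem -/

/-- If the itinerary never hits the scale exponent before time `t`, it stays `≥ 1` on `[1, t]` (phase A persists). -/
theorem phaseA_of_noB (t : ℕ) (_ht : t ≤ k)
    (hne : ∀ s, s < t → mIt k i s ≠ nS k s) : ∀ s, 1 ≤ s → s ≤ t → 1 ≤ mIt k i s := by
  intro s hs1 hst
  obtain ⟨s', rfl⟩ : ∃ s', s = s' + 1 := ⟨s - 1, by omega⟩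
  have h := hne s' (by omega)
  show 1 ≤ Nat.dist (mIt k i s') (nS k s')
  rw [Nat.dist.eq_def]; omega

/-- The final ratio `v_k` is `< 4` for odd `i` and `> 4` for even `i` (`k ≥ 1`, `i ≤ 2^k`). -/
theorem vIt_final (hk : 1 ≤ k) (hi : i ≤ 2 ^ k) :
    (i % 2 = 1 → vIt k i k < 4) ∧ (i % 2 = 0 → 4 < vIt k i k) := by
  by_cases hP : ∃ t, t + 1 ≤ k ∧ mIt k i t = nS k t
  · -- phase A ends at the first `T` with `m_T = n_T`
    let T := Nat.find hP
    have hT : T + 1 ≤ k ∧ mIt k i T = nS k T := Nat.find_spec hP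
    have hmin : ∀ t, t < T → ¬ (t + 1 ≤ k ∧ mIt k i t = nS k t) := fun t ht => Nat.find_min hP ht
    have hA : ∀ s, 1 ≤ s → s ≤ T → 1 ≤ mIt k i s :=
      phaseA_of_noB T (by omega) (fun s hs heq => hmin s hs ⟨by omega, heq⟩)
    have hb := phaseA_bounds (k := k) (i := i) T hA
    have hFle := FA_le_const hk hi T (by omega) hA
    have hpar := mIt_mod_two (k := k) (i := i) hk T hT.1
    rw [hT.2] at hb hpar
    set L : ℝ := (16:ℝ) ^ nS k T with hLdef
    have hL : 0 < L := by positivity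
    have hvT := vIt_pos (k := k) (i := i) T
    have hB : 2 ≤ vIt k i (T + 1) ∧ vIt k i (T + 1) ≤ 22 / 10 :=
      stepB L (FA k i T) (vIt k i T) hL hFle hb.1 hb.2 hvT
    rcases Nat.eq_or_lt_of_le hT.1 with hTk | hTk
    · -- B at the last level: `i` odd, `v_k ∈ [2, 2.2]`
      have hn1 : nS k T = 1 := by rw [← nS_last (k := k) hk]; congr 1; omega
      rw [hn1] at hpar
      rw [hTk] at hB
      exact ⟨fun _ => by linarith [hB.2], fun h0 => by omega⟩
    · -- B before the last level: `i` even, then phase C keeps `v` large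
      have hn2 := nS_succ (k := k) T (by omega)
      rw [hn2] at hpar
      have hev : i % 2 = 0 := by omega
      refine ⟨fun h1 => by omega, fun _ => ?_⟩
      have hC : ∀ t, T + 2 ≤ t → t ≤ k →
          (16:ℝ) ^ nS k (t - 1) / (22 / 10) ≤ vIt k i t ∧
          vIt k i t ≤ (16:ℝ) ^ nS k (t - 1) / 2 + (23 / 10) / (16:ℝ) ^ nS k (t - 1) := by
        intro t ht htk
        induction t, ht using Nat.le_induction with
        | base =>
          have hL' : (16:ℝ) ≤ (16:ℝ) ^ nS k (T + 1) := by
            calc (16:ℝ) = 16 ^ 1 := by norm_num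
              _ ≤ 16 ^ nS k (T + 1) := pow_le_pow_right₀ (by norm_num) (nS_pos _)
          have := stepCstart ((16:ℝ) ^ nS k (T + 1)) (vIt k i (T + 1)) hL' hB.1 hB.2
          rw [show T + 2 - 1 = T + 1 by omega]
          exact this
        | succ t ht ih =>
          have ih' := ih (by omega)
          rw [show t + 1 - 1 = t by omega]
          have hsq : (16:ℝ) ^ nS k (t - 1) = ((16:ℝ) ^ nS k t) ^ 2 := by
            rw [← pow_mul]; congr 1
            have := nS_succ (k := k) (t - 1) (by omega)
            rw [show t - 1 + 1 = t by omega] at this; omega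
          rw [hsq] at ih'
          have hL' : (16:ℝ) ≤ (16:ℝ) ^ nS k t := by
            calc (16:ℝ) = 16 ^ 1 := by norm_num
              _ ≤ 16 ^ nS k t := pow_le_pow_right₀ (by norm_num) (nS_pos _)
          exact stepC ((16:ℝ) ^ nS k t) (vIt k i t) hL' ih'.1 ih'.2
      have hk' := hC k (by omega) le_rfl
      rw [nS_last hk] at hk'
      norm_num at hk'
      linarith [hk'.1]
  · -- no B: phase A all the way, `i` even, `v_k ≥ 16/1.1`
    push Not at hP
    have hA : ∀ s, 1 ≤ s → s ≤ k → 1 ≤ mIt k i s :=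
      phaseA_of_noB k le_rfl (fun s hs heq => hP s (by omega) heq)
    have hb := phaseA_bounds (k := k) (i := i) k hA
    have hFle := FA_le_const hk hi k le_rfl hA
    have hF1 := one_le_FA (k := k) (i := i) k
    have hpar := mIt_mod_two (k := k) (i := i) hk (k - 1) (by omega)
    have hle := mIt_le (k := k) (i := i) hk hi (k - 1) (by omega)
    have hne := hP (k - 1) (by omega)
    rw [nS_last hk] at hle hne
    have hev : i % 2 = 0 := by omega
    refine ⟨fun h1 => by omega, fun _ => ?_⟩
    have hmk := hA k hk le_rfl
    have h16 : (16:ℝ) ≤ (16:ℝ) ^ mIt k i k := by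
      calc (16:ℝ) = 16 ^ 1 := by norm_num
        _ ≤ 16 ^ mIt k i k := pow_le_pow_right₀ (by norm_num) hmk
    have h1 := hb.1
    rw [div_le_iff₀ (by linarith)] at h1
    nlinarith

/-- **The W-tower grid signs hold at every level `k ≥ 1`.** -/
theorem wTowerSigns_all (k : ℕ) (hk : 1 ≤ k) : WTowerSigns k := by
  intro i hi
  obtain ⟨h1, h2⟩ := vIt_final (k := k) (i := i) hk (by omega)
  obtain ⟨e1, e2⟩ := sign_iff k i
  exact ⟨fun h => e1.2 (h2 h), fun h => e2.2 (h1 h)⟩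


/-- **`HexRealZeroTauBound c` is FALSE for every `c` (v10, sorry-free): the hexadecadal sector does NOT
escape the `TauRealZeros` barrier — the W-tower `W_k` (τ ≤ k²+12k+5, `2^k` hexadecadal real roots) is a
barrier family INSIDE the sector.** -/
theorem not_hexRealZeroTauBound (c : ℕ) : ¬ HexRealZeroTauBound c :=
  not_hexRealZeroTauBound_of_wTowerSigns (fun k hk => wTowerSigns_all k hk) c

end WTower

end Summit.ValiantsHypothesis.ValiantsHypothesis.Theorems.LacunarySymmetroidMatrixDescartes.Hexadecade
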